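import Summits.FinalStateConjecture.FinalStateConjecture.Theorems.EIHFluxBalanceInertialRecessionSlavingNullCovectorHessian

/-!
# Route EIHFluxBalance — `InertialRecession` (E′), K1 slaving: AXIS tables of the second partials of the
# Kerr–Schild null covector

Helper file for the crux `stmt-FinalStateConjecture-17403` (2-jet tables, part 4). At an axis point
`(t, 0, 0, z)`, `z ≠ 0` (where `r = |z|`), the general quotient-rule formulas of
`…SlavingNullCovectorHessian` specialise to: `∂₁₃ℓ₁ = ∂₃₁ℓ₁ = ∂₂₃ℓ₂ = ∂₃₂ℓ₂ = (z/|z|)(a² − z²)/(z² + a²)²`,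
`∂₂₃ℓ₁ = ∂₃₂ℓ₁ = −2az/(z² + a²)²`, `∂₁₃ℓ₂ = ∂₃₁ℓ₂ = 2az/(z² + a²)²`, `∂₁₁ℓ₃ = ∂₂₂ℓ₃ = −(z/|z|)/(z² + a²)`,
all other spatial second partials of `ℓ₁, ℓ₂, ℓ₃` vanish. No definitions, no `sorry`. [folklore]
-/

set_option linter.dupNamespace false

noncomputable section

open scoped Topology
open Filter Set Function Literature.Geometry.Lorentzian Literature.Geometry.Lorentzian.Kerr

namespace Summit.FinalStateConjecture.FinalStateConjecture.Theorems.SublinearIsFree.Slaving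

section Axis

variable {a : ℝ} {y : E4} (h1 : y 1 = 0) (h2 : y 2 = 0) (hz : y 3 ≠ 0)
include h1 h2 hz

/-- **Axis table for `∂²ℓ₁`** at `(t, 0, 0, z)`, `z ≠ 0`. [folklore] -/
theorem axis_fderiv_fderiv_nullCovectorFun_one (i j : Fin 3) :
    fderiv ℝ (fun w ↦ fderiv ℝ (fun x ↦ nullCovectorFun a x 1) w (E4.basisVector i.succ)) y
        (E4.basisVector j.succ) =
      ![![0, 0, y 3 / |y 3| * (a ^ 2 - y 3 ^ 2) / (y 3 ^ 2 + a ^ 2) ^ 2],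
        ![0, 0, -(2 * a * y 3 / (y 3 ^ 2 + a ^ 2) ^ 2)],
        ![y 3 / |y 3| * (a ^ 2 - y 3 ^ 2) / (y 3 ^ 2 + a ^ 2) ^ 2, -(2 * a * y 3 / (y 3 ^ 2 + a ^ 2) ^ 2), 0]]
        i j := by
  have hr0 := axis_radius_pos (a := a) h1 h2 hz
  have hr := axis_radius (a := a) h1 h2
  have hdr := axis_fderiv_radius (a := a) h1 h2 hz
  have hHr := axis_fderiv_fderiv_radius (a := a) h1 h2 hz
  have hD : y 3 ^ 2 + a ^ 2 ≠ 0 := by positivity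
  rw [fderiv_fderiv_nullCovectorFun_one hr0]
  rcases lt_or_gt_of_ne hz with hneg | hpos
  · have habs : |y 3| = -y 3 := abs_of_neg hneg
    have hone : y 3 / |y 3| = -1 := by rw [habs, div_neg, div_self hz]
    have hz' : -y 3 ≠ 0 := neg_ne_zero.2 hz
    simp only [hone] at hdr
    simp only [hHr, hdr, hr, habs, h1, h2]
    fin_cases i <;> fin_cases j <;> simp [E4.basisVector] <;> field_simp <;> ring
  · have habs : |y 3| = y 3 := abs_of_pos hpos
    have hone : y 3 / |y 3| = 1 := by rw [habs, div_self hz]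
    simp only [hone] at hdr
    simp only [hHr, hdr, hr, habs, h1, h2]
    fin_cases i <;> fin_cases j <;> simp [E4.basisVector] <;> field_simp <;> ring

/-- **Axis table for `∂²ℓ₂`** at `(t, 0, 0, z)`, `z ≠ 0`. [folklore] -/
theorem axis_fderiv_fderiv_nullCovectorFun_two (i j : Fin 3) :
    fderiv ℝ (fun w ↦ fderiv ℝ (fun x ↦ nullCovectorFun a x 2) w (E4.basisVector i.succ)) y
        (E4.basisVector j.succ) =
      ![![0, 0, 2 * a * y 3 / (y 3 ^ 2 + a ^ 2) ^ 2],
        ![0, 0, y 3 / |y 3| * (a ^ 2 - y 3 ^ 2) / (y 3 ^ 2 + a ^ 2) ^ 2],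
        ![2 * a * y 3 / (y 3 ^ 2 + a ^ 2) ^ 2, y 3 / |y 3| * (a ^ 2 - y 3 ^ 2) / (y 3 ^ 2 + a ^ 2) ^ 2, 0]]
        i j := by
  have hr0 := axis_radius_pos (a := a) h1 h2 hz
  have hr := axis_radius (a := a) h1 h2
  have hdr := axis_fderiv_radius (a := a) h1 h2 hz
  have hHr := axis_fderiv_fderiv_radius (a := a) h1 h2 hz
  have hD : y 3 ^ 2 + a ^ 2 ≠ 0 := by positivity
  rw [fderiv_fderiv_nullCovectorFun_two hr0]
  rcases lt_or_gt_of_ne hz with hneg | hpos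
  · have habs : |y 3| = -y 3 := abs_of_neg hneg
    have hone : y 3 / |y 3| = -1 := by rw [habs, div_neg, div_self hz]
    have hz' : -y 3 ≠ 0 := neg_ne_zero.2 hz
    simp only [hone] at hdr
    simp only [hHr, hdr, hr, habs, h1, h2]
    fin_cases i <;> fin_cases j <;> simp [E4.basisVector] <;> field_simp <;> ring
  · have habs : |y 3| = y 3 := abs_of_pos hpos
    have hone : y 3 / |y 3| = 1 := by rw [habs, div_self hz]
    simp only [hone] at hdr
    simp only [hHr, hdr, hr, habs, h1, h2]
    fin_cases i <;> fin_cases j <;> simp [E4.basisVector] <;> field_simp <;> ring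

/-- **Axis table for `∂²ℓ₃`** at `(t, 0, 0, z)`, `z ≠ 0`: `∂₁₁ℓ₃ = ∂₂₂ℓ₃ = −(z/|z|)/(z² + a²)`. [folklore] -/
theorem axis_fderiv_fderiv_nullCovectorFun_three (i j : Fin 3) :
    fderiv ℝ (fun w ↦ fderiv ℝ (fun x ↦ nullCovectorFun a x 3) w (E4.basisVector i.succ)) y
        (E4.basisVector j.succ) =
      ![![-(y 3 / |y 3| / (y 3 ^ 2 + a ^ 2)), 0, 0],
        ![0, -(y 3 / |y 3| / (y 3 ^ 2 + a ^ 2)), 0],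
        ![0, 0, 0]] i j := by
  have hr0 := axis_radius_pos (a := a) h1 h2 hz
  have hr := axis_radius (a := a) h1 h2
  have hdr := axis_fderiv_radius (a := a) h1 h2 hz
  have hHr := axis_fderiv_fderiv_radius (a := a) h1 h2 hz
  have hD : y 3 ^ 2 + a ^ 2 ≠ 0 := by positivity
  rw [fderiv_fderiv_nullCovectorFun_three hr0]
  rcases lt_or_gt_of_ne hz with hneg | hpos
  · have habs : |y 3| = -y 3 := abs_of_neg hneg
    have hone : y 3 / |y 3| = -1 := by rw [habs, div_neg, div_self hz]
    have hz' : -y 3 ≠ 0 := neg_ne_zero.2 hz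
    simp only [hone] at hdr
    simp only [hHr, hdr, hr, habs]
    fin_cases i <;> fin_cases j <;> simp [E4.basisVector] <;> field_simp
  · have habs : |y 3| = y 3 := abs_of_pos hpos
    have hone : y 3 / |y 3| = 1 := by rw [habs, div_self hz]
    simp only [hone] at hdr
    simp only [hHr, hdr, hr, habs]
    fin_cases i <;> fin_cases j <;> simp [E4.basisVector] <;> field_simp

end Axis

/-- Registered carrier `slaving_axisNullCovectorHessian_slaving12` of the crux item
(= `axis_fderiv_fderiv_nullCovectorFun_three`). [folklore] -/
theorem slaving_axisNullCovectorHessian_slaving12 : open Literature.Geometry.Lorentzian in ∀ {a : ℝ} {y : E4}, y 1 = 0 → y 2 = 0 → y 3 ≠ 0 → ∀ i j : Fin 3, fderiv ℝ (fun w ↦ fderiv ℝ (fun x ↦ Kerr.nullCovectorFun a x 3) w (E4.basisVector i.succ)) y (E4.basisVector j.succ) = ![![-(y 3 / |y 3| / (y 3 ^ 2 + a ^ 2)), 0, 0], ![0, -(y 3 / |y 3| / (y 3 ^ 2 + a ^ 2)), 0], ![0, 0, 0]] i j :=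
  fun h1 h2 hz i j ↦ axis_fderiv_fderiv_nullCovectorFun_three h1 h2 hz i j

end Summit.FinalStateConjecture.FinalStateConjecture.Theorems.SublinearIsFree.Slaving
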